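import Summits.QuantumAdvantage.QuantumAdvantage.Theorems.CubicForrelationNearExactIsExactCubicFormRadical

/-!
# Crux `CubicForrelation.NearExactIsExact` (stmt-QuantumAdvantage-14043) — the family `R` of the `s₀ω₄` cell lemma: two rank-two forms
  whose sum has rank four are supported on the support of the sum ("`D ∈ R ⇒ D ∈ Λ²P*`")

Certificate seat `b2b-cforr-cert` (gen 41).  HONEST FRAMING: kernel-checked linear algebra over `𝔽₂` (standard axioms; kernels by counting,
no `Matrix.rank`).  In the `s₀ω₄` branch of E1280-even a cell of weight `< 160` has halves with forms `B₀`, `B₁`, `B₀ ⊕ B₁ = ω` of rank `4`,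
and either one of them vanishes or both have rank `2` (…CubicFormHalvesRankTwo `tcl_halves_eight_mu2`, family `R` of
HOME/b2b-cforr-cert-g37/R2-PARTNER.md §3 L2).  THIS FILE: in the rank-`2`/rank-`2` case both `B₀` and `B₁` vanish on `Rad ω × 𝔽₂ⁿ`, i.e.
`D, D′` are "supported on `P × P`" — the only property of `R` used by HOME/b2b-cforr-cert-g39/E1280-HANDPROOFS.md §1.6.  Proof: if
`x ∈ Rad ω` had `φ := B₀(x,·) = B₁(x,·) ≠ 0`, then `φ ∈ span(p, q) ∩ span(p′, q′)`, so `p, q, p′, q′` span a space of dimension `≤ 3` and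
`Rad ω` would contain the common kernel of three functionals (`≥ 2ⁿ⁻³` vectors), against `#Rad ω = 2ⁿ⁻⁴` (…CubicFormRadical).
Nothing about `θ₁₂`; NOT summit progress.

* `tw4_ker_step`, `tw4_ker3_card`: the common kernel of three additive functionals has at least `2ⁿ/8` elements.
* `tw4_R_support`: the statement above.

References: E1280-HANDPROOFS.md §1.6; R2-PARTNER.md §3 (L2, family R).  Axioms: the standard three.
-/

set_option linter.dupNamespace false -- D-0017: single-problem summit ⇒ `QuantumAdvantage.QuantumAdvantage` by design

namespace Summit.QuantumAdvantage.QuantumAdvantage.Theorems.CubicForrelation.NearExactIsExact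

open Finset
open Literature.Computability.QuantumComplexity.BuzetChailloux (bxor zeroVec bxor_comm bxor_self bxor_zeroVec zeroVec_bxor
  bxor_bxor_cancel_left)

variable {n : ℕ}

/-- **Kernel step.**  Inside an xor-closed set `S ∋ 0`, the zero set of an additive functional has at least half the elements. [folklore] -/
theorem tw4_ker_step (S : Finset (Fin n → Bool)) (hS : ∀ x ∈ S, ∀ y ∈ S, bxor x y ∈ S) (h0 : zeroVec ∈ S)
    (l : (Fin n → Bool) → Bool) (hl : ∀ x y, l (bxor x y) = (l x ^^ l y)) :
    #S ≤ 2 * #(S.filter fun x => l x = false) := by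
  classical
  have hS3 : ∀ x ∈ S, ∀ y ∈ S, ∀ z ∈ S, bxor x (bxor y z) ∈ S := fun x hx y hy z hz => hS x hx _ (hS y hy z hz)
  have hl3 : ∀ x ∈ S, ∀ y ∈ S, ∀ z ∈ S, l (bxor x (bxor y z)) = ((l x ^^ l y) ^^ l z) := fun x _ y _ z _ => by
    rw [hl, hl]; cases l x <;> cases l y <;> cases l z <;> rfl
  have hsum := card_filter_add_card_filter_not (s := S) (fun x => l x = true)
  have hneg : (S.filter fun x => ¬ l x = true) = S.filter fun x => l x = false := filter_congr fun x _ => by simp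
  rw [hneg] at hsum
  have hl0 : l zeroVec = false := by
    have e := hl zeroVec zeroVec; rw [bxor_self] at e; revert e; cases l zeroVec <;> decide
  rcases tce_affine_dichotomy S l hS3 hl3 with h | h | h
  · omega
  · omega
  · -- `l ≡ 1` on `S` contradicts `l 0 = 0`
    exfalso
    have hmem : zeroVec ∈ S.filter fun x => l x = true := by
      rw [Finset.filter_eq_self.2 fun x hx => ?_]
      · exact h0
      · have := Finset.eq_of_subset_of_card_le (Finset.filter_subset (fun x => l x = true) S) (by rw [h])
        rw [← this] at hx
        exact (mem_filter.1 hx).2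
    have := (mem_filter.1 hmem).2
    rw [hl0] at this
    exact Bool.false_ne_true this

/-- **Three functionals.**  The common zero set of three additive functionals on `𝔽₂ⁿ` has `≥ 2ⁿ / 8` elements. [folklore] -/
theorem tw4_ker3_card (l₁ l₂ l₃ : (Fin n → Bool) → Bool) (h₁ : ∀ x y, l₁ (bxor x y) = (l₁ x ^^ l₁ y))
    (h₂ : ∀ x y, l₂ (bxor x y) = (l₂ x ^^ l₂ y)) (h₃ : ∀ x y, l₃ (bxor x y) = (l₃ x ^^ l₃ y)) :
    2 ^ n ≤ 8 * #(univ.filter fun x : Fin n → Bool => l₁ x = false ∧ l₂ x = false ∧ l₃ x = false) := by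
  classical
  have hz : ∀ (l : (Fin n → Bool) → Bool), (∀ x y, l (bxor x y) = (l x ^^ l y)) → l zeroVec = false := fun l hl => by
    have e := hl zeroVec zeroVec; rw [bxor_self] at e; revert e; cases l zeroVec <;> decide
  set S₁ := univ.filter fun x : Fin n → Bool => l₁ x = false with hS₁
  set S₂ := S₁.filter fun x => l₂ x = false with hS₂
  have e₁ := tw4_ker_step (univ : Finset (Fin n → Bool)) (fun _ _ _ _ => mem_univ _) (mem_univ _) l₁ h₁
  have hS₁x : ∀ x ∈ S₁, ∀ y ∈ S₁, bxor x y ∈ S₁ := by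
    intro x hx y hy
    rw [hS₁, mem_filter] at hx hy ⊢
    exact ⟨mem_univ _, by rw [h₁, hx.2, hy.2]; rfl⟩
  have hS₁0 : zeroVec ∈ S₁ := by rw [hS₁, mem_filter]; exact ⟨mem_univ _, hz l₁ h₁⟩
  have e₂ := tw4_ker_step S₁ hS₁x hS₁0 l₂ h₂
  have hS₂x : ∀ x ∈ S₂, ∀ y ∈ S₂, bxor x y ∈ S₂ := by
    intro x hx y hy
    rw [hS₂, mem_filter] at hx hy ⊢
    exact ⟨hS₁x x hx.1 y hy.1, by rw [h₂, hx.2, hy.2]; rfl⟩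
  have hS₂0 : zeroVec ∈ S₂ := by rw [hS₂, mem_filter]; exact ⟨hS₁0, hz l₂ h₂⟩
  have e₃ := tw4_ker_step S₂ hS₂x hS₂0 l₃ h₃
  have hS₃ : S₂.filter (fun x => l₃ x = false) = univ.filter fun x : Fin n → Bool => l₁ x = false ∧ l₂ x = false ∧ l₃ x = false := by
    rw [hS₂, hS₁, filter_filter, filter_filter]
  have hd : #S₁ = #(univ.filter fun x : Fin n → Bool => l₁ x = false) := by rw [hS₁]
  have hc : #S₂ = #(S₁.filter fun x => l₂ x = false) := by rw [hS₂]
  rw [card_univ, Fintype.card_fun, Fintype.card_bool, Fintype.card_fin] at e₁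
  rw [hS₃] at e₃
  omega

/-- **Family `R` is supported on `P × P`.**  `B₀ = p∧q`, `B₁ = p′∧q′` (each given by two vectors), `ω = B₀ ⊕ B₁` with a maximal frame of
size two: then `B₀` and `B₁` vanish on every frame-orthogonal (= radical) vector of `ω`. [this work; E1280-HANDPROOFS §1.6] -/
theorem tw4_R_support (B₀ B₁ ω : (Fin n → Bool) → (Fin n → Bool) → Bool)
    (hs₀ : ∀ x y, B₀ x y = B₀ y x) (ha₀ : ∀ x y z, B₀ (bxor x y) z = (B₀ x z ^^ B₀ y z))
    (hs₁ : ∀ x y, B₁ x y = B₁ y x) (ha₁ : ∀ x y z, B₁ (bxor x y) z = (B₁ x z ^^ B₁ y z))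
    (hω : ∀ x y, ω x y = (B₀ x y ^^ B₁ x y))
    (p₀ q₀ : Fin n → Bool) (hP₀ : ∀ x y, B₀ x y = ((B₀ x q₀ && B₀ y p₀) ^^ (B₀ x p₀ && B₀ y q₀)))
    (p₁ q₁ : Fin n → Bool) (hP₁ : ∀ x y, B₁ x y = ((B₁ x q₁ && B₁ y p₁) ^^ (B₁ x p₁ && B₁ y q₁)))
    (b c : Fin 2 → (Fin n → Bool))
    (hbc : ∀ i, ω (b i) (c i) = true) (hbc' : ∀ i j, i ≠ j → ω (b i) (c j) = false) (hbb : ∀ i j, ω (b i) (b j) = false)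
    (hmax : ∀ x y, (∀ i, ω x (b i) = false) → (∀ i, ω x (c i) = false) → (∀ i, ω y (b i) = false) → (∀ i, ω y (c i) = false) →
      ω x y = false)
    (x : Fin n → Bool) (hxb : ∀ i, ω x (b i) = false) (hxc : ∀ i, ω x (c i) = false) (y : Fin n → Bool) :
    B₀ x y = false ∧ B₁ x y = false := by
  classical
  have hsω : ∀ x y, ω x y = ω y x := fun x y => by rw [hω, hω, hs₀, hs₁]
  have haω : ∀ x y z, ω (bxor x y) z = (ω x z ^^ ω y z) := fun x y z => by
    rw [hω, hω, hω, ha₀, ha₁]; cases B₀ x z <;> cases B₀ y z <;> cases B₁ x z <;> cases B₁ y z <;> rfl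
  -- `x` is in the radical of `ω`, so `B₀(x,·) = B₁(x,·)`
  have hrad : ∀ z, ω x z = false := fun z => tce_radical_of_orth ω hsω haω 2 b c hbc hbc' hbb hmax x hxb hxc z
  have h01 : ∀ z, B₁ x z = B₀ x z := fun z => by
    have e := hrad z; rw [hω] at e; revert e; cases B₀ x z <;> cases B₁ x z <;> decide
  -- suppose `φ := B₀(x,·) ≠ 0`
  by_contra hne
  have hy : B₀ x y = true := by
    by_contra h0
    have h0' : B₀ x y = false := by revert h0; cases B₀ x y <;> simp
    exact hne ⟨h0', by rw [h01, h0']⟩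
  -- the third functional
  set l₃ : (Fin n → Bool) → Bool := fun z => if B₁ x p₁ = true then B₁ z p₁ else B₁ z q₁ with hl₃
  have hl₃add : ∀ u v, l₃ (bxor u v) = (l₃ u ^^ l₃ v) := by
    intro u v; simp only [hl₃]; split_ifs <;> exact ha₁ u v _
  -- the common kernel of `B₀(·,p₀)`, `B₀(·,q₀)`, `l₃` lies in `Rad ω`
  have hK : (univ.filter fun z : Fin n → Bool => B₀ z p₀ = false ∧ B₀ z q₀ = false ∧ l₃ z = false) ⊆
      univ.filter fun z : Fin n → Bool => ∀ w, ω z w = false := by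
    intro z hz
    obtain ⟨k1, k2, k3⟩ := (mem_filter.1 hz).2
    rw [mem_filter]
    refine ⟨mem_univ _, fun w => ?_⟩
    -- `B₀(z,·) = 0`
    have hz0 : ∀ w, B₀ z w = false := fun w => by rw [hP₀, k1, k2]; cases B₀ w p₀ <;> cases B₀ w q₀ <;> rfl
    -- `B₁(z, p₁) = B₁(z, q₁) = 0`
    have e1 : B₁ x z = false := by rw [h01, hs₀, hz0]
    have e2 := hP₁ x z
    have e3 := hP₁ x y
    rw [h01 y, hy] at e3
    rw [e1] at e2
    have hz1 : B₁ z p₁ = false ∧ B₁ z q₁ = false := by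
      simp only [hl₃] at k3
      revert e2 e3 k3
      cases B₁ x p₁ <;> cases B₁ x q₁ <;> cases B₁ z p₁ <;> cases B₁ z q₁ <;> cases B₁ y p₁ <;> cases B₁ y q₁ <;> simp
    rw [hω, hz0, hP₁, hz1.1, hz1.2]
    cases B₁ w p₁ <;> cases B₁ w q₁ <;> rfl
  -- counting: `2ⁿ ≤ 8 #K`, `#K ≤ #Rad ω = 2ⁿ⁻⁴`
  have hK8 := tw4_ker3_card (fun z => B₀ z p₀) (fun z => B₀ z q₀) l₃ (fun u v => ha₀ u v p₀) (fun u v => ha₀ u v q₀) hl₃add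
  obtain ⟨hn, hR⟩ := tce_radical_card ω hsω haω 2 b c hbc hbc' hbb hmax
  have hle := card_le_card hK
  rw [hR] at hle
  have hpow : 2 ^ n = 2 ^ (n - 2 * 2) * 16 := by
    rw [show (16 : ℕ) = 2 ^ 4 by norm_num, ← pow_add]; congr 1; omega
  have hpos : 1 ≤ 2 ^ (n - 2 * 2) := Nat.one_le_two_pow
  omega

end Summit.QuantumAdvantage.QuantumAdvantage.Theorems.CubicForrelation.NearExactIsExact
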